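import Literature.NumberTheory.Automorphic.PrincipalSeriesGL2JacquetModule
import Literature.NumberTheory.Automorphic.JacquetModuleProofs
import Literature.NumberTheory.Automorphic.HeckeTransversalGL
import Literature.NumberTheory.Automorphic.SatakeParametersGLProofs
import Literature.NumberTheory.Automorphic.GL2UnramifiedLFactorDivisibility
import HarnessLib

/-!
# The Satake parameters of an unramified principal series of `GL₂` are the values of the inducing characters

Topic `Literature/NumberTheory/Automorphic`; proof file (theorems only: no definition, no named fact,
no instance).  Let `F` be a non-archimedean local field with residue field of cardinality `q`, `ϖ` a
uniformizing element, `B = P_id ≤ GL₂(F)` the upper Borel subgroup with Levi quotient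
`T = Π_a GL₁(F)`, and `σ` a representation of `T` on `W ≠ 0` acting through a pair of UNRAMIFIED
characters `χ₁, χ₂ : Fˣ → ℂˣ`: `σ(proj d(u, v)) = χ₁(u) χ₂(v)` on `W`.  The normalised principal series
is `I(σ) = Ind_B^{GL₂}(σ ∘ proj ⊗ δ_B^{1/2})` (`Representation.parabolicIndGL F id σ`).

**Theorem** (`isSatakeParameter_parabolicIndGL_fin_two`): `{χ₁(ϖ), χ₂(ϖ)}` is a Satake parameter of
`I(σ)` in the sense of the tree's `IsSatakeParameter` (`SatakeParametersGL`, Shimura/Tamagawa unitary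
normalisation): the spherical vector `f₀` (`f₀(bk) = (σ∘proj ⊗ δ^{1/2})(b) w₀`, Bump 1997,
Prop. 4.5.2 / Thm. 4.6.4; the tree's `exists_mem_fixedPoints_glInt_parabolicIndGL_fin_two`) satisfies
`T₁ f₀ = q^{1/2}(χ₁(ϖ) + χ₂(ϖ)) f₀`, `T₂ f₀ = χ₁(ϖ)χ₂(ϖ) f₀` (and `T₀ f₀ = f₀`) — Cartier, Corvallis
1979, §IV (3.3)–(4.2) (the spherical function `Γ_χ`), Bump 1997, Prop. 4.6.6, Macdonald 1995, V (3.4):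
the classical computation behind «the unramified principal series `π(χ₁, χ₂)` has Satake parameters
`(χ₁(ϖ), χ₂(ϖ))` and `L(s, π) = L(s, χ₁) L(s, χ₂)`» (Jacquet–Langlands 1970, Prop. 3.5).

## Proof

A `GL₂(𝒪)`-fixed `f ∈ I(σ)` is determined by `f(1)` (`f(bk) = (σ∘proj ⊗ δ^{1/2})(b) f(1)`, Iwasawa
`G = BK`, `exists_borel_mul_glInt`), so `T f = c f` as soon as `(T f)(1) = c f(1)` (§1).  By the explicit
transversal `{u_a ϖ^{ε_S}}` of `K t_r K / K` (`heckeT_apply_eq_sum`, `HeckeTransversalGL`),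
`(T_r f)(1) = ∑_{(S,ā)} f(u_a ϖ^{ε_S}) = ∑_{(S,ā)} (σ∘proj ⊗ δ^{1/2})(ϖ^{ε_S}) f(1)`, the echelon unipotent
`u_a` lying in the unipotent radical of `B` (§2).  With `δ_B(d(a, d)) = |a/d|_F` (the tree's proved
convention check `deltaChar_borel_gl_two_holds`; `standardParabolicGL F id` IS
`DiophantineGeometry.borelSubgroup`), `δ^{1/2}(d(ϖ,1)) = q^{-1/2}`, `δ^{1/2}(d(1,ϖ)) = q^{1/2}`, and the
count `q` resp. `1` of the representatives over the pivot sets `{1}` resp. `{0}`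
(`sum_transversalIndex_of_fst`): `(T₁ f₀)(1) = (q · q^{-1/2} χ₁(ϖ) + q^{1/2} χ₂(ϖ)) f₀(1)`; and
`T₂ = I(ϖ · 1)` on fixed vectors (`heckeT_self_apply`), `δ(ϖ · 1) = 1` (§3–§4).
This is the local input «S4a» of the d6 line of cell hodgecm-mathlib (Satake parameters of the
split-place model `Ind(ν ⊠ χν⁻¹)` of [Liu2021, Lem. D.1]); nothing of [Liu2021] is used or asserted here.

## References

* P. Cartier, *Representations of 𝔭-adic groups: a survey*, PSPM 33 (1979), part 1, §IV, (3.3), (4.2).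
  [CartierCorvallis1979]
* D. Bump, *Automorphic forms and representations* (1997), Prop. 4.5.2, §4.5 (5.1)–(5.2), Thm. 4.6.4,
  Prop. 4.6.6.
  [Bump1997]
* H. Jacquet, R. P. Langlands, *Automorphic forms on GL(2)*, LNM 114 (1970), Prop. 3.5.
  [JacquetLanglands1970]
* I. G. Macdonald, *Symmetric functions and Hall polynomials*, 2nd ed. (1995), Ch. V (3.4).
  [Macdonald1995]
-/

noncomputable section

open scoped MatrixGroups NNReal
open ValuativeRel Finset

namespace Literature.NumberTheory.Automorphic

open GaloisRepresentations.IsNonarchimedeanLocalField (normAbs residueFieldCard residueFieldCard_ne_zero)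

section PrincipalSeriesSatake

variable {F : Type*} [Field F] [ValuativeRel F] [TopologicalSpace F] [IsNonarchimedeanLocalField F]
variable {W : Type*} [AddCommGroup W] [Module ℂ W]
  (σ : Representation ℂ (Π a, GL {i // (id : Fin 2 → Fin 2) i = a} F) W)

/-! ### §1 Fixed vectors of `I(σ)` are determined by their value at `1` -/

/-- A `GL₂(𝒪)`-fixed `f ∈ I(σ)` takes the same value on all of `GL₂(𝒪)`: `f(k) = f(1)`
(`f(k) = (I(k) f)(1)`). [cite: Bump1997, Prop. 4.5.2] -/
theorem toFun_eq_toFun_one_of_mem_fixedPoints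
    {f : Representation.SmoothInd (standardParabolicGL F (id : Fin 2 → Fin 2))
      (Representation.twist (MonoidHom.comp σ (leviProjection F (id : Fin 2 → Fin 2)))
        (rootDeltaChar (standardParabolicGL F (id : Fin 2 → Fin 2))))}
    (hf : f ∈ (Representation.parabolicIndGL F (id : Fin 2 → Fin 2) σ).fixedPoints (glInt 2 F))
    {k : GL (Fin 2) F} (hk : k ∈ glInt 2 F) : f.toFun k = f.toFun 1 := by
  have h := ((Representation.parabolicIndGL F (id : Fin 2 → Fin 2) σ).mem_fixedPoints _ f).1 hf k hk
  calc f.toFun k = f.toFun (1 * k) := by rw [one_mul]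
    _ = ((Representation.parabolicIndGL F (id : Fin 2 → Fin 2) σ) k f).toFun 1 := by
        rw [parabolicIndGL_fin_two_apply, Representation.toFun_smoothIndRep_apply]
    _ = f.toFun 1 := by rw [h]

/-- **`f(bk) = (σ∘proj ⊗ δ^{1/2})(b) f(1)`** for a `GL₂(𝒪)`-fixed `f ∈ I(σ)`, `b ∈ B`, `k ∈ GL₂(𝒪)`.
[cite: Bump1997, Prop. 4.5.2] -/
theorem toFun_borel_mul_of_mem_fixedPoints
    {f : Representation.SmoothInd (standardParabolicGL F (id : Fin 2 → Fin 2))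
      (Representation.twist (MonoidHom.comp σ (leviProjection F (id : Fin 2 → Fin 2)))
        (rootDeltaChar (standardParabolicGL F (id : Fin 2 → Fin 2))))}
    (hf : f ∈ (Representation.parabolicIndGL F (id : Fin 2 → Fin 2) σ).fixedPoints (glInt 2 F))
    (b : ↥(standardParabolicGL F (id : Fin 2 → Fin 2))) {k : GL (Fin 2) F} (hk : k ∈ glInt 2 F) :
    f.toFun ((b : GL (Fin 2) F) * k) =
      (Representation.twist (MonoidHom.comp σ (leviProjection F (id : Fin 2 → Fin 2)))
        (rootDeltaChar (standardParabolicGL F (id : Fin 2 → Fin 2)))) b (f.toFun 1) := by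
  rw [Representation.SmoothInd.toFun_subgroup_mul, toFun_eq_toFun_one_of_mem_fixedPoints σ hf hk]

/-- **Two `GL₂(𝒪)`-fixed vectors of `I(σ)` with the same value at `1` are equal** (Iwasawa
decomposition `GL₂(F) = B · GL₂(𝒪)`). [cite: Bump1997, Prop. 4.5.2 and Thm. 4.6.2] -/
theorem eq_of_mem_fixedPoints_of_toFun_one_eq
    {f g : Representation.SmoothInd (standardParabolicGL F (id : Fin 2 → Fin 2))
      (Representation.twist (MonoidHom.comp σ (leviProjection F (id : Fin 2 → Fin 2)))
        (rootDeltaChar (standardParabolicGL F (id : Fin 2 → Fin 2))))}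
    (hf : f ∈ (Representation.parabolicIndGL F (id : Fin 2 → Fin 2) σ).fixedPoints (glInt 2 F))
    (hg : g ∈ (Representation.parabolicIndGL F (id : Fin 2 → Fin 2) σ).fixedPoints (glInt 2 F))
    (h1 : f.toFun 1 = g.toFun 1) : f = g := by
  refine Representation.SmoothInd.ext (funext fun x => ?_)
  obtain ⟨b, hb, k, hk, rfl⟩ := exists_borel_mul_glInt x
  rw [toFun_borel_mul_of_mem_fixedPoints σ hf ⟨b, hb⟩ hk,
    toFun_borel_mul_of_mem_fixedPoints σ hg ⟨b, hb⟩ hk, h1]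

/-- **Eigenvector criterion**: a linear operator `T` preserving the `GL₂(𝒪)`-fixed vectors acts on a
fixed `f` by the scalar `c` as soon as `(T f)(1) = c · f(1)`. [cite: Bump1997, Prop. 4.6.6] -/
theorem apply_eq_smul_of_toFun_one_eq
    {f : Representation.SmoothInd (standardParabolicGL F (id : Fin 2 → Fin 2))
      (Representation.twist (MonoidHom.comp σ (leviProjection F (id : Fin 2 → Fin 2)))
        (rootDeltaChar (standardParabolicGL F (id : Fin 2 → Fin 2))))}
    (hf : f ∈ (Representation.parabolicIndGL F (id : Fin 2 → Fin 2) σ).fixedPoints (glInt 2 F))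
    (T : Module.End ℂ (Representation.SmoothInd (standardParabolicGL F (id : Fin 2 → Fin 2))
      (Representation.twist (MonoidHom.comp σ (leviProjection F (id : Fin 2 → Fin 2)))
        (rootDeltaChar (standardParabolicGL F (id : Fin 2 → Fin 2))))))
    (hT : T f ∈ (Representation.parabolicIndGL F (id : Fin 2 → Fin 2) σ).fixedPoints (glInt 2 F))
    (c : ℂ) (h1 : (T f).toFun 1 = c • f.toFun 1) : T f = c • f :=
  eq_of_mem_fixedPoints_of_toFun_one_eq σ hT (Submodule.smul_mem _ c hf)
    (by rw [h1, Representation.SmoothInd.toFun_smul, Pi.smul_apply])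

/-! ### §2 The Hecke operators `T_r` on a fixed vector, read at `1` -/

omit [ValuativeRel F] [TopologicalSpace F] [IsNonarchimedeanLocalField F] in
/-- `ϖ^ε = diag(ϖ^{ε₀}, ϖ^{ε₁}) ∈ B`. [folklore] -/
private theorem piPowGL_mem_standardParabolicGL_fin_two {ϖ : F} (hϖ : ϖ ≠ 0) (ε : Fin 2 → ℕ) :
    piPowGL hϖ ε ∈ standardParabolicGL F (id : Fin 2 → Fin 2) := by
  rw [mem_standardParabolicGL_iff, coe_piPowGL]
  intro i j hij
  rw [Echelon.piPow_apply, if_neg]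
  rintro rfl
  exact lt_irrefl _ hij


/-- **`(T_r f)(1) = ∑_{(S, ā)} f(u_a ϖ^{ε_S})`** for a `GL₂(𝒪)`-fixed `f ∈ I(σ)` and `r ≤ 2`: the
explicit transversal of `K t_r K / K` (`heckeT_apply_eq_sum`) and `(I(y) f)(1) = f(y)`.
[cite: CartierCorvallis1979, §IV (3.3)] -/
theorem toFun_one_heckeT_eq_sum {ϖ : F} (hϖ : IsUniformizingElement ϖ) {r : ℕ} (hr : r ≤ 2)
    {f : Representation.SmoothInd (standardParabolicGL F (id : Fin 2 → Fin 2))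
      (Representation.twist (MonoidHom.comp σ (leviProjection F (id : Fin 2 → Fin 2)))
        (rootDeltaChar (standardParabolicGL F (id : Fin 2 → Fin 2))))}
    (hf : f ∈ (Representation.parabolicIndGL F (id : Fin 2 → Fin 2) σ).fixedPoints (glInt 2 F)) :
    (heckeT (Representation.parabolicIndGL F (id : Fin 2 → Fin 2) σ) (Units.mk0 ϖ hϖ.ne_zero) r f).toFun 1 =
      ∑ p : TransversalIndex 2 F r, f.toFun (p.rep hϖ.ne_zero) := by
  -- evaluation at `1` is linear
  let ev : Representation.SmoothInd (standardParabolicGL F (id : Fin 2 → Fin 2))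
      (Representation.twist (MonoidHom.comp σ (leviProjection F (id : Fin 2 → Fin 2)))
        (rootDeltaChar (standardParabolicGL F (id : Fin 2 → Fin 2)))) →ₗ[ℂ] W :=
    { toFun := fun f => f.toFun 1
      map_add' := fun f g => by rw [Representation.SmoothInd.toFun_add, Pi.add_apply]
      map_smul' := fun c f => by
        rw [Representation.SmoothInd.toFun_smul, Pi.smul_apply, RingHom.id_apply] }
  have hev : ∀ g, ev g = g.toFun 1 := fun _ => rfl
  rw [heckeT_apply_eq_sum _ hϖ hr hf, ← hev, map_sum]
  refine Finset.sum_congr rfl fun p _ => ?_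
  rw [hev, parabolicIndGL_fin_two_apply, Representation.toFun_smoothIndRep_apply, one_mul]

/-- **The value of a fixed vector at a representative `u_a ϖ^{ε_S}`**: `f(u_a ϖ^{ε_S}) =
(σ∘proj ⊗ δ^{1/2})(ϖ^{ε_S}) f(1)` — the echelon unipotent `u_a ∈ U ≤ B` acts trivially through the
inducing datum. [cite: CartierCorvallis1979, §IV (3.3)] -/
theorem toFun_rep_eq {ϖ : F} (hϖ : IsUniformizingElement ϖ) {r : ℕ}
    {f : Representation.SmoothInd (standardParabolicGL F (id : Fin 2 → Fin 2))
      (Representation.twist (MonoidHom.comp σ (leviProjection F (id : Fin 2 → Fin 2)))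
        (rootDeltaChar (standardParabolicGL F (id : Fin 2 → Fin 2))))}
    (hf : f ∈ (Representation.parabolicIndGL F (id : Fin 2 → Fin 2) σ).fixedPoints (glInt 2 F))
    (p : TransversalIndex 2 F r) :
    f.toFun (p.rep hϖ.ne_zero) =
      (Representation.twist (MonoidHom.comp σ (leviProjection F (id : Fin 2 → Fin 2)))
        (rootDeltaChar (standardParabolicGL F (id : Fin 2 → Fin 2))))
        ⟨piPowGL hϖ.ne_zero (epsOf p.1.1), piPowGL_mem_standardParabolicGL_fin_two hϖ.ne_zero _⟩
        (f.toFun 1) := by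
  obtain ⟨⟨S, ā⟩, hS, h⟩ := p
  -- the unipotent factor `u_a ∈ U = U_id`, as an element of `B`
  have hu : echelonGL h ∈ unipotentRadicalGL F (id : Fin 2 → Fin 2) := echelonGL_mem_upperUnitriangular h
  obtain ⟨u, hu', hueq⟩ := Subgroup.mem_map.1 hu
  rw [Subgroup.coe_subtype] at hueq
  have hd := piPowGL_mem_standardParabolicGL_fin_two hϖ.ne_zero (epsOf S)
  change f.toFun (heckeRep hϖ.ne_zero h) = _
  have hprod : heckeRep hϖ.ne_zero h =
      ((u * ⟨piPowGL hϖ.ne_zero (epsOf S), hd⟩ : ↥(standardParabolicGL F (id : Fin 2 → Fin 2))) :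
        GL (Fin 2) F) * 1 := by
    rw [mul_one, Subgroup.coe_mul, hueq, heckeRep_eq_mul]
  rw [hprod, toFun_borel_mul_of_mem_fixedPoints σ hf _ (Subgroup.one_mem _), map_mul, Module.End.mul_apply,
    twist_comp_leviProjection_apply_of_mem_unipotentRadicalP σ ⟨u, hu'⟩]

/-! ### §3 `δ_B^{1/2}` and the inducing datum on the diagonal -/

/-- **`δ_B^{1/2}(p) = |p₀₀ / p₁₁|_F^{1/2}`** on the Borel of `GL₂(F)` (from the tree's proved convention
check `deltaChar_borel_gl_two_holds`; `standardParabolicGL F id` is `DiophantineGeometry.borelSubgroup`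
definitionally). [cite: Bump1997, §4.5 (5.1)–(5.2)] -/
theorem coe_rootDeltaChar_standardParabolicGL_fin_two (p : ↥(standardParabolicGL F (id : Fin 2 → Fin 2))) :
    ((rootDeltaChar (standardParabolicGL F (id : Fin 2 → Fin 2)) p : ℂˣ) : ℂ) =
      ((NNReal.sqrt (normAbs F (((p : GL (Fin 2) F) : Matrix (Fin 2) (Fin 2) F) 0 0 /
        ((p : GL (Fin 2) F) : Matrix (Fin 2) (Fin 2) F) 1 1)) : ℝ≥0) : ℝ) := by
  haveI : LocallyCompactSpace ↥(DiophantineGeometry.borelSubgroup (Fin 2) F) :=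
    inferInstanceAs (LocallyCompactSpace ↥(standardParabolicGL F (id : Fin 2 → Fin 2)))
  have h : ((deltaChar (standardParabolicGL F (id : Fin 2 → Fin 2)) p : ℂˣ) : ℂ) = _ :=
    deltaChar_borel_gl_two_holds F p
  rw [deltaChar_apply] at h
  have h' : MeasureTheory.Measure.modularCharacter p =
      normAbs F (((p : GL (Fin 2) F) : Matrix (Fin 2) (Fin 2) F) 0 0 /
        ((p : GL (Fin 2) F) : Matrix (Fin 2) (Fin 2) F) 1 1) :=
    NNReal.coe_injective (Complex.ofReal_injective h)
  rw [rootDeltaChar_apply, h']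

/-- The inducing datum on a diagonal element of `B`: `(σ∘proj ⊗ δ^{1/2})(d(a,b)) w =
|a/b|^{1/2} χ₁(a) χ₂(b) w` when `σ ∘ proj` acts through `(χ₁, χ₂)`. [cite: Bump1997, §4.5 (5.1)–(5.2)] -/
theorem twist_diagGL2_apply (χ₁ χ₂ : Fˣ →* ℂˣ)
    (hσ : ∀ (u v : Fˣ) (w : W), σ (leviProjection F (id : Fin 2 → Fin 2)
      ⟨diagGL2 u v, diagGL2_mem_standardParabolicGL_fin_two u v⟩) w = ((χ₁ u * χ₂ v : ℂˣ) : ℂ) • w)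
    (a b : Fˣ) (hd : diagGL2 a b ∈ standardParabolicGL F (id : Fin 2 → Fin 2)) (w : W) :
    (Representation.twist (MonoidHom.comp σ (leviProjection F (id : Fin 2 → Fin 2)))
        (rootDeltaChar (standardParabolicGL F (id : Fin 2 → Fin 2)))) ⟨diagGL2 a b, hd⟩ w =
      (((NNReal.sqrt (normAbs F ((a : F) / b)) : ℝ≥0) : ℝ) : ℂ) • ((χ₁ a * χ₂ b : ℂˣ) : ℂ) • w := by
  rw [Representation.twist_apply, coe_rootDeltaChar_standardParabolicGL_fin_two, MonoidHom.comp_apply]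
  have : σ (leviProjection F (id : Fin 2 → Fin 2) ⟨diagGL2 a b, hd⟩) w = ((χ₁ a * χ₂ b : ℂˣ) : ℂ) • w :=
    hσ a b w
  rw [this, coe_diagGL2]
  simp

/-! ### §4 The theorem -/

/-- the pivot sets of size `1` in `Fin 2`. [folklore] -/
private theorem filter_card_eq_one_fin_two :
    ((Finset.univ : Finset (Finset (Fin 2))).filter fun S => S.card = 2 - 1) = { {0}, {1} } := by decide

/-- `c({0}) = 0`. [folklore] -/
private theorem card_echelonPositions_singleton_zero : (echelonPositions ({0} : Finset (Fin 2))).card = 0 := by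
  decide

/-- `c({1}) = 1`. [folklore] -/
private theorem card_echelonPositions_singleton_one : (echelonPositions ({1} : Finset (Fin 2))).card = 1 := by
  decide

/-- `ε_{{0}} = (0, 1)`. [folklore] -/
private theorem epsOf_singleton_zero : epsOf ({0} : Finset (Fin 2)) = ![0, 1] := by
  funext i; fin_cases i <;> rfl

/-- `ε_{{1}} = (1, 0)`. [folklore] -/
private theorem epsOf_singleton_one : epsOf ({1} : Finset (Fin 2)) = ![1, 0] := by
  funext i; fin_cases i <;> rfl

/-- **The Satake parameters of the unramified principal series of `GL₂(F)`.**  Let `σ` be a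
representation of the diagonal torus `T = Π_a GL₁(F)` on `W ≠ 0` acting through UNRAMIFIED characters
`χ₁, χ₂ : Fˣ → ℂˣ` (`σ(proj d(u,v)) = χ₁(u)χ₂(v)`, `χ_i(𝒪ˣ) = 1`), and `ϖ` a uniformizing element.  Then
`{χ₁(ϖ), χ₂(ϖ)}` is a Satake parameter of the normalised principal series
`I(σ) = Ind_B^{GL₂}(σ ∘ proj ⊗ δ_B^{1/2})` (`Representation.parabolicIndGL F id σ`): on the spherical
vector `f₀`, `T₁ f₀ = q^{1/2}(χ₁(ϖ)+χ₂(ϖ)) f₀` and `T₂ f₀ = χ₁(ϖ)χ₂(ϖ) f₀` — Cartier's formula for the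
spherical function (Corvallis 1979, §IV (3.3), (4.2)) / Bump 1997, Prop. 4.6.6, i.e. the Satake
parameter of `π(χ₁, χ₂)` is `(χ₁(ϖ), χ₂(ϖ))` (Jacquet–Langlands 1970, Prop. 3.5:
`L(s, π(μ₁,μ₂)) = L(s,μ₁)L(s,μ₂)`). [cite: CartierCorvallis1979, §IV (4.2)] [cite: Bump1997, Prop. 4.6.6] -/
theorem isSatakeParameter_parabolicIndGL_fin_two [Nontrivial W] (χ₁ χ₂ : Fˣ →* ℂˣ)
    (hσ : ∀ (u v : Fˣ) (w : W), σ (leviProjection F (id : Fin 2 → Fin 2)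
      ⟨diagGL2 u v, diagGL2_mem_standardParabolicGL_fin_two u v⟩) w = ((χ₁ u * χ₂ v : ℂˣ) : ℂ) • w)
    (h₁ : ∀ u : Fˣ, valuation F (u : F) = 1 → χ₁ u = 1)
    (h₂ : ∀ u : Fˣ, valuation F (u : F) = 1 → χ₂ u = 1)
    {ϖ : F} (hϖ : IsUniformizingElement ϖ) :
    IsSatakeParameter (Representation.parabolicIndGL F (id : Fin 2 → Fin 2) σ) (Units.mk0 ϖ hϖ.ne_zero)
      {((χ₁ (Units.mk0 ϖ hϖ.ne_zero) : ℂˣ) : ℂ), ((χ₂ (Units.mk0 ϖ hϖ.ne_zero) : ℂˣ) : ℂ)} := by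
  classical
  set ϖu : Fˣ := Units.mk0 ϖ hϖ.ne_zero with hϖu
  -- the inducing datum is trivial on `B ∩ GL₂(𝒪)`: the spherical vector exists
  have htriv : ∀ p : ↥(standardParabolicGL F (id : Fin 2 → Fin 2)), (p : GL (Fin 2) F) ∈ glInt 2 F →
      ∀ w : W, σ (leviProjection F (id : Fin 2 → Fin 2) p) w = w := by
    refine apply_leviProjection_eq_of_mem_glInt σ (fun u hu w => ?_) (fun u hu w => ?_)
    · rw [hσ, h₁ u hu, one_mul, h₂ 1 (by simp), Units.val_one, one_smul]
    · rw [hσ, h₂ u hu, mul_one, h₁ 1 (by simp), Units.val_one, one_smul]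
  obtain ⟨f₀, hf₀0, hf₀⟩ := exists_mem_fixedPoints_glInt_parabolicIndGL_fin_two σ htriv
  have hq0 : ((residueFieldCard F : ℝ≥0) : ℝ) ≠ 0 := by exact_mod_cast residueFieldCard_ne_zero F
  have hnϖ : normAbs F ϖ = (residueFieldCard F : ℝ≥0)⁻¹ := normAbs_eq_inv_of_isUniformizingElement hϖ
  -- the value of the inducing datum at `ϖ^{ε_S}` for the two pivot sets, and at `ϖ · 1`
  have hval : ∀ (k l : ℕ) (hd : piPowGL hϖ.ne_zero ![k, l] ∈ standardParabolicGL F (id : Fin 2 → Fin 2)) (w : W),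
      (Representation.twist (MonoidHom.comp σ (leviProjection F (id : Fin 2 → Fin 2)))
          (rootDeltaChar (standardParabolicGL F (id : Fin 2 → Fin 2)))) ⟨piPowGL hϖ.ne_zero ![k, l], hd⟩ w =
        (((NNReal.sqrt (normAbs F (ϖ ^ k / ϖ ^ l)) : ℝ≥0) : ℝ) : ℂ) •
          ((χ₁ ϖu ^ k * χ₂ ϖu ^ l : ℂˣ) : ℂ) • w := by
    intro k l hd w
    have hd' : diagGL2 (ϖu ^ k) (ϖu ^ l) ∈ standardParabolicGL F (id : Fin 2 → Fin 2) :=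
      diagGL2_mem_standardParabolicGL_fin_two _ _
    have he : (⟨piPowGL hϖ.ne_zero ![k, l], hd⟩ : ↥(standardParabolicGL F (id : Fin 2 → Fin 2))) =
        ⟨diagGL2 (ϖu ^ k) (ϖu ^ l), hd'⟩ := Subtype.ext (piPowGL_fin_two hϖ.ne_zero k l)
    rw [he, twist_diagGL2_apply σ χ₁ χ₂ hσ, map_pow, map_pow]
    simp [hϖu]
  -- finiteness of the orbits `K t_r K / K` (from the explicit transversal)
  have hfin : ∀ {r : ℕ}, r ≤ 2 →
      (MulAction.orbit (glInt 2 F) ((heckeDiag 2 ϖu r : GL (Fin 2) F) : GL (Fin 2) F ⧸ glInt 2 F)).Finite := by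
    intro r hr
    rw [← (bijOn_heckeTransversal (n := 2) hϖ hr).image_eq]
    exact (Finset.finite_toSet _).image _
  -- scalar bookkeeping: `q`, `√q`, `|ϖ|`
  haveI : Fintype 𝓀[F] := Fintype.ofFinite _
  have hqcard : (Fintype.card 𝓀[F] : ℂ) = (residueFieldCard F : ℂ) := by
    rw [residueFieldCard, Nat.card_eq_fintype_card]
  have hqR : ((residueFieldCard F : ℝ≥0) : ℝ) = (residueFieldCard F : ℝ) := by norm_cast
  have hsqrt : ((NNReal.sqrt (residueFieldCard F : ℝ≥0) : ℝ≥0) : ℝ) = Real.sqrt (residueFieldCard F) := by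
    rw [Real.coe_sqrt, hqR]
  have hsq : Real.sqrt (residueFieldCard F) * Real.sqrt (residueFieldCard F) = (residueFieldCard F : ℝ) :=
    Real.mul_self_sqrt (Nat.cast_nonneg _)
  have hsqrt0 : (Real.sqrt (residueFieldCard F) : ℂ) ≠ 0 := by
    have : (0 : ℝ) < Real.sqrt (residueFieldCard F) :=
      Real.sqrt_pos.2 (by exact_mod_cast Nat.pos_of_ne_zero (residueFieldCard_ne_zero F))
    exact_mod_cast this.ne'
  have hn01 : normAbs F (ϖ ^ 0 / ϖ ^ 1) = (residueFieldCard F : ℝ≥0) := by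
    rw [pow_zero, pow_one, one_div, map_inv₀, hnϖ, inv_inv]
  have hn10 : normAbs F (ϖ ^ 1 / ϖ ^ 0) = (residueFieldCard F : ℝ≥0)⁻¹ := by
    rw [pow_one, pow_zero, div_one, hnϖ]
  have hn11 : normAbs F (ϖ ^ 1 / ϖ ^ 1) = 1 := by
    rw [div_self (pow_ne_zero _ hϖ.ne_zero), map_one]
  -- elementary symmetric functions of a pair
  have he1 : ∀ a b : ℂ, ({a, b} : Multiset ℂ).esymm 1 = a + b := fun a b => by
    simp [Multiset.esymm, Multiset.powersetCard_one, add_comm]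
  have he2 : ∀ a b : ℂ, ({a, b} : Multiset ℂ).esymm 2 = a * b := fun a b => by
    rw [Multiset.insert_eq_cons, Multiset.esymm, Multiset.powersetCard_cons]
    simp [Multiset.powersetCard_one]
  have he0 : ∀ a b : ℂ, ({a, b} : Multiset ℂ).esymm 0 = 1 := fun a b => by
    simp [Multiset.esymm]
  refine ⟨by simp, f₀, hf₀, hf₀0, fun i hi => ?_⟩
  -- the three Hecke operators `T₀, T₁, T₂`
  interval_cases i
  · -- `T₀ = 1`
    have h0 : heckeDiag 2 ϖu 0 = 1 := by
      refine Units.ext ?_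
      rw [coe_heckeDiag, Units.val_one]
      ext i j
      simp [Matrix.one_apply, Matrix.diagonal_apply]
    rw [heckeT_def, h0, heckeOperator_one_apply _ _ hf₀, he0, zero_mul, pow_zero, Complex.ofReal_one,
      one_mul, one_smul]
  · -- `T₁`: `(T₁ f₀)(1) = (1 · √q χ₂(ϖ) + q · √q⁻¹ χ₁(ϖ)) f₀(1)`
    have hT1fix : heckeT (Representation.parabolicIndGL F (id : Fin 2 → Fin 2) σ) ϖu 1 f₀ ∈
        (Representation.parabolicIndGL F (id : Fin 2 → Fin 2) σ).fixedPoints (glInt 2 F) := by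
      rw [heckeT_def]
      exact heckeOperator_apply_mem_fixedPoints _ _ _ hf₀ (hfin (by norm_num))
    refine apply_eq_smul_of_toFun_one_eq σ hf₀ _ hT1fix _ ?_
    rw [toFun_one_heckeT_eq_sum σ hϖ (by norm_num) hf₀]
    simp_rw [toFun_rep_eq σ hϖ hf₀]
    rw [sum_transversalIndex_of_fst (n := 2) (F := F) 1 (fun S =>
      (Representation.twist (MonoidHom.comp σ (leviProjection F (id : Fin 2 → Fin 2)))
        (rootDeltaChar (standardParabolicGL F (id : Fin 2 → Fin 2))))
        ⟨piPowGL hϖ.ne_zero (epsOf S), piPowGL_mem_standardParabolicGL_fin_two hϖ.ne_zero _⟩ (f₀.toFun 1)),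
      filter_card_eq_one_fin_two, Finset.sum_pair (by decide), card_echelonPositions_singleton_zero,
      card_echelonPositions_singleton_one, pow_zero, pow_one, one_smul]
    have hA := hval 0 1 (epsOf_singleton_zero ▸ piPowGL_mem_standardParabolicGL_fin_two hϖ.ne_zero _) (f₀.toFun 1)
    have hB := hval 1 0 (epsOf_singleton_one ▸ piPowGL_mem_standardParabolicGL_fin_two hϖ.ne_zero _) (f₀.toFun 1)
    have hA' : (Representation.twist (MonoidHom.comp σ (leviProjection F (id : Fin 2 → Fin 2)))
        (rootDeltaChar (standardParabolicGL F (id : Fin 2 → Fin 2))))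
        ⟨piPowGL hϖ.ne_zero (epsOf ({0} : Finset (Fin 2))), piPowGL_mem_standardParabolicGL_fin_two hϖ.ne_zero _⟩
          (f₀.toFun 1) =
        (((NNReal.sqrt (normAbs F (ϖ ^ 0 / ϖ ^ 1)) : ℝ≥0) : ℝ) : ℂ) •
          ((χ₁ ϖu ^ 0 * χ₂ ϖu ^ 1 : ℂˣ) : ℂ) • f₀.toFun 1 := by
      rw [← hA]; congr 2; exact Subtype.ext (congrArg (piPowGL hϖ.ne_zero) epsOf_singleton_zero)
    have hB' : (Representation.twist (MonoidHom.comp σ (leviProjection F (id : Fin 2 → Fin 2)))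
        (rootDeltaChar (standardParabolicGL F (id : Fin 2 → Fin 2))))
        ⟨piPowGL hϖ.ne_zero (epsOf ({1} : Finset (Fin 2))), piPowGL_mem_standardParabolicGL_fin_two hϖ.ne_zero _⟩
          (f₀.toFun 1) =
        (((NNReal.sqrt (normAbs F (ϖ ^ 1 / ϖ ^ 0)) : ℝ≥0) : ℝ) : ℂ) •
          ((χ₁ ϖu ^ 1 * χ₂ ϖu ^ 0 : ℂˣ) : ℂ) • f₀.toFun 1 := by
      rw [← hB]; congr 2; exact Subtype.ext (congrArg (piPowGL hϖ.ne_zero) epsOf_singleton_one)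
    rw [hA', hB', hn01, hn10, NNReal.sqrt_inv, NNReal.coe_inv, hsqrt, he1, ← Nat.cast_smul_eq_nsmul ℂ,
      hqcard, smul_smul, smul_smul, smul_smul, ← add_smul]
    congr 1
    push_cast
    simp only [pow_zero, pow_one, one_mul, mul_one]
    -- `√q χ₂ + q (√q)⁻¹ χ₁ = √q (χ₁ + χ₂)`
    have hq : (residueFieldCard F : ℂ) = (Real.sqrt (residueFieldCard F) : ℂ) * Real.sqrt (residueFieldCard F) := by
      exact_mod_cast hsq.symm
    rw [hq]
    field_simp
    ring
  · -- `T₂ = I(ϖ · 1)` on fixed vectors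
    rw [heckeT_self_apply _ ϖu hf₀]
    have hzfix : (Representation.parabolicIndGL F (id : Fin 2 → Fin 2) σ) (heckeDiag 2 ϖu 2) f₀ ∈
        (Representation.parabolicIndGL F (id : Fin 2 → Fin 2) σ).fixedPoints (glInt 2 F) := by
      rw [Representation.mem_fixedPoints]
      intro k hk
      rw [← Module.End.mul_apply, ← map_mul, mul_heckeDiag_self_comm, map_mul, Module.End.mul_apply,
        ((Representation.parabolicIndGL F (id : Fin 2 → Fin 2) σ).mem_fixedPoints _ f₀).1 hf₀ k hk]
    refine apply_eq_smul_of_toFun_one_eq σ hf₀ _ hzfix _ ?_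
    have hz : heckeDiag 2 ϖu 2 = piPowGL hϖ.ne_zero ![1, 1] := by
      rw [heckeDiag_two_two, piPowGL_fin_two, pow_one]
    have hC := hval 1 1 (hz ▸ hz.symm ▸ piPowGL_mem_standardParabolicGL_fin_two hϖ.ne_zero _) (f₀.toFun 1)
    rw [parabolicIndGL_fin_two_apply, Representation.toFun_smoothIndRep_apply, one_mul,
      show heckeDiag 2 ϖu 2 = ((⟨piPowGL hϖ.ne_zero ![1, 1], piPowGL_mem_standardParabolicGL_fin_two hϖ.ne_zero _⟩ :
        ↥(standardParabolicGL F (id : Fin 2 → Fin 2))) : GL (Fin 2) F) * 1 by rw [mul_one]; exact hz,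
      toFun_borel_mul_of_mem_fixedPoints σ hf₀ _ (Subgroup.one_mem _), hC, hn11, NNReal.sqrt_one,
      NNReal.coe_one, Complex.ofReal_one, one_smul, he2, Nat.sub_self, mul_zero, pow_zero,
      Complex.ofReal_one, one_mul, pow_one, pow_one, Units.val_mul]

end PrincipalSeriesSatake

end Literature.NumberTheory.Automorphic

end
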